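import Mathlib.NumberTheory.Cyclotomic.Gal
import Mathlib.RingTheory.Polynomial.Cyclotomic.Roots
import Mathlib.NumberTheory.MulChar.Basic
import Literature.NumberTheory.EllipticCurves.CuspFormLFunction
import HarnessLib

/-!
# Kato's finiteness of the `χ`-part of the Mordell–Weil group (Astérisque 295, Cor. 14.3)

K. Kato, *`p`-adic Hodge theory and values of zeta functions of modular forms*, Astérisque 295
(2004), §14, proves (Thm. 14.2, p. 235): for a normalised newform `f` of weight `k` and level `N`,
a finite abelian extension `K/ℚ` and a character `χ : Gal(K/ℚ) → ℂˣ` with `L(f, χ, k/2) ≠ 0`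
(`k` even), the `χ`-part `Sel(K, T)^(χ)` of the Selmer group of every Galois-stable lattice `T` of
`V_{F_λ}(f)(k/2)` is finite; and deduces (Cor. 14.3, p. 235): for an abelian variety `A/ℚ` which is
a quotient of `J₁(N)`, `K/ℚ` finite abelian and `χ` a character of `Gal(K/ℚ)` with
`L(A, χ, 1) ≠ 0`, (1) the `χ`-part of `Sel(K, A ⊗_ℚ K)` is finite and (2) the `χ`-part `A(K)^(χ)`
of the Mordell–Weil group is finite. Here (Kato, p. 235) `G = Gal(K/ℚ)`, `I_χ ⊂ ℤ[G]` is the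
kernel of the ring homomorphism `ℤ[G] → ℂ` induced by `χ`, and the `χ`-part of a `G`-module `M`
is `M^(χ) = {x ∈ M ; I_χ · x = 0}`; `L(f, χ, s)` means `L_S(f, χ, s) = ∑_{(n,S)=1} aₙ χ(n) n⁻ˢ`
(Kato 6.2, p. 161) where `χ` is identified with the composite
`(ℤ/m)ˣ ≅ Gal(ℚ(ζ_m)/ℚ) → Gal(K/ℚ) → ℂˣ` for the smallest `m ≥ 1` with `K ⊂ ℚ(ζ_m)` and
`S = prime(m)`.

This file vendors, as a NAMED FACT (D-0014), part (2) of Cor. 14.3 for `A = E` an elliptic curve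
over `ℚ` with newform `f` (`IsNewformOf W f`, the tree's modularity glue; `E` is then a quotient of
`J₀(N)`, hence of `J₁(N)`, and `L(E, χ, s) = L(f, χ, s)`) and `K = ℚ(ζ_m)`
(`CyclotomicField m ℚ`) with `m ≢ 2 (mod 4)` (so that `m` is the least modulus of `K` and
`S = prime(m)`; nothing is lost since `ℚ(ζ_m) = ℚ(ζ_{m/2})` for `m ≡ 2 (mod 4)`):

* `Literature.NumberTheory.EllipticCurves.chiPart ρ χ` — Kato's `χ`-part `M^(χ)` of an additive
  group `M` with operators `ρ : G → (M →+ M)`, for `χ : G → R`;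
* `Literature.NumberTheory.EllipticCurves.cyclotomicCharacterOf χ` — the character of
  `Gal(ℚ(ζ_m)/ℚ)` attached to a Dirichlet character `χ` mod `m` through
  `Gal(ℚ(ζ_m)/ℚ) ≅ (ℤ/m)ˣ`, `σ ↦ a` with `σ(ζ) = ζ^a` (Mathlib `IsCyclotomicExtension.autEquivPow`);
* `Literature.NumberTheory.EllipticCurves.kato_finite_chiPart_of_twistedLValue_ne_zero` — the fact:
  `L(f, χ, 1) ≠ 0 ⇒ E(ℚ(ζ_m))^(χ)` is finite.

The hypothesis `L(f, χ, 1) ≠ 0` is spelled, as elsewhere in the tree (`NonvanishingSevenTwists`,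
`exists_differentiable_eq_twistedLSeries`), through an entire continuation `L` of the twisted
`L`-series `twistedLSeries f χ s = ∑ χ(n) aₙ(f) n⁻ˢ` (absolutely convergent for `re s > 2`; the
continuation exists, `exists_differentiable_eq_twistedLSeries_holds`, and is unique by the identity
theorem): since a Dirichlet character mod `m` vanishes off `(ℤ/m)ˣ`, this series is literally
Kato's `L_{prime(m)}(f, χ, s)`.

## What is NOT here

* Part (1) of Cor. 14.3 (the `χ`-part of the Selmer group `Sel(K, E)`) and Thm. 14.2 itself
  (lattices in `V_{F_λ}(f)(r)`, `1 ≤ r ≤ k - 1`): the `Gal(K/ℚ)`-action on the tree's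
  `selmerGroupPInfty (W.baseChange K) p` (continuous cohomology of `Γ_K`) is not yet available.
* TODO(general form): `K` an arbitrary finite abelian extension of `ℚ`. For `K ⊂ ℚ(ζ_m)` of
  conductor `m` and `χ` a character of `Gal(K/ℚ)` inflated to `χ̃` on `Gal(ℚ(ζ_m)/ℚ)`, the natural
  injection `E(K) → E(ℚ(ζ_m))` maps `E(K)^(χ)` into `E(ℚ(ζ_m))^(χ̃)` (the image of `I_χ̃` in
  `ℤ[Gal(K/ℚ)]` is `I_χ`) and `L(f, χ̃, s) = L(f, χ, s)`, so the case vendored here implies the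
  general one.
* The trivial-character case over `ℚ` (`m = 1`) is the tree's `kato_finite_of_L_one_ne_zero`
  (`PAdicBSD.lean`, bsd.S20), stated there with `W.entireLFunction`.

## References

* K. Kato, *`p`-adic Hodge theory and values of zeta functions of modular forms*, Astérisque 295
  (2004), 117–290: §6.2 (p. 161, `L_S(f, χ, s)`), §14.1 (Selmer groups), Thm. 14.2 and
  Cor. 14.3 (p. 235), remark on `χ`-quotients (p. 236). [Kato2004Asterisque]
* K. Rubin, *Euler systems*, Annals of Math. Studies 147 (2000), Thm. 3.5.4, Cor. 3.5.6 (the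
  case `K = ℚ`).
-/

noncomputable section

open scoped BigOperators

open WeierstrassCurve WeierstrassCurve.Affine CongruenceSubgroup Polynomial

namespace Literature.NumberTheory.EllipticCurves

/-! ### Kato's `χ`-part of a module over a group ring -/

section ChiPart

variable {G M R : Type*} [AddCommGroup M] [CommRing R]

/-- **Kato's `χ`-part.** For an additive group `M` on which `G` operates through additive maps
`ρ g : M →+ M` (a `ℤ[G]`-module when `ρ` is a group action) and a function `χ : G → R` into a
commutative ring (a character `G → ℂˣ ⊂ ℂ` in the source), the `χ`-part of `M` is
`M^(χ) = {x ∈ M ; I_χ · x = 0}`, where `I_χ ⊂ ℤ[G]` is the kernel of the additive (ring, when `χ`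
is a character) homomorphism `ℤ[G] → R`, `∑ n_g g ↦ ∑ n_g χ(g)`, and `(∑ n_g g) · x = ∑ n_g ρ(g)(x)`;
elements of `ℤ[G]` are finitely supported functions `a : G →₀ ℤ`. (Kato, Astérisque 295, p. 235,
display after Thm. 14.2.) [cite: Kato2004Asterisque, §14 Thm. 14.2 (p. 235)] -/
def chiPart (ρ : G → M →+ M) (χ : G → R) : AddSubgroup M where
  carrier := {x | ∀ a : G →₀ ℤ, (a.sum fun g n => (n : R) * χ g) = 0 →
    (a.sum fun g n => n • ρ g x) = 0}
  zero_mem' := fun a _ => by simp [Finsupp.sum]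
  add_mem' := fun {x y} hx hy a ha => by
    simp only [map_add, smul_add, Finsupp.sum_add, hx a ha, hy a ha, add_zero]
  neg_mem' := fun {x} hx a ha => by
    simp only [map_neg, smul_neg, Finsupp.sum_neg, hx a ha, neg_zero]

/-- Membership in the `χ`-part: `x ∈ M^(χ)` iff every `a = ∑ n_g g ∈ ℤ[G]` with `∑ n_g χ(g) = 0`
kills `x`. (Kato, Astérisque 295, p. 235.) [cite: Kato2004Asterisque, §14 Thm. 14.2 (p. 235)] -/
theorem mem_chiPart_iff (ρ : G → M →+ M) (χ : G → R) (x : M) :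
    x ∈ chiPart ρ χ ↔ ∀ a : G →₀ ℤ, (a.sum fun g n => (n : R) * χ g) = 0 →
      (a.sum fun g n => n • ρ g x) = 0 :=
  Iff.rfl

/-- On the `χ`-part the operators `ρ g` only depend on `χ(g)`: if `χ g = χ h` then `g - h ∈ I_χ`,
so `ρ g x = ρ h x` for `x ∈ M^(χ)` (in particular `M^(1) ⊂ M^G` when `ρ 1 = id`). [folklore] -/
theorem apply_eq_apply_of_mem_chiPart {ρ : G → M →+ M} {χ : G → R} {x : M}
    (hx : x ∈ chiPart ρ χ) {g h : G} (hgh : χ g = χ h) : ρ g x = ρ h x := by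
  classical
  have key := hx (Finsupp.single g 1 - Finsupp.single h 1) (by
    rw [Finsupp.sum_sub_index (fun _ _ _ => by push_cast; ring)]
    simp [hgh])
  rw [Finsupp.sum_sub_index (fun _ _ _ => sub_smul _ _ _)] at key
  simpa [sub_eq_zero] using key

end ChiPart

/-! ### Dirichlet characters as characters of `Gal(ℚ(ζ_m)/ℚ)` -/

section Cyclotomic

variable {m : ℕ} [NeZero m]

set_option backward.isDefEq.respectTransparency false in
/-- The character of `Gal(ℚ(ζ_m)/ℚ)` attached to a Dirichlet character `χ` mod `m`: the composite
`Gal(ℚ(ζ_m)/ℚ) ≅ (ℤ/m)ˣ → ℂˣ` of the canonical isomorphism `σ ↦ a`, `σ(ζ) = ζ^a` for every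
`m`-th root of unity `ζ` (Mathlib `IsCyclotomicExtension.autEquivPow`, available since the `m`-th
cyclotomic polynomial is irreducible over `ℚ`), with the restriction of `χ` to units. This is the
identification "`(ℤ/m)ˣ ≅ Gal(ℚ(ζ_m)/ℚ) → ℂˣ`" of Kato, Astérisque 295, remark after Thm. 14.2
(p. 235), for `K = ℚ(ζ_m)`. (The option `backward.isDefEq.respectTransparency false`
identifies the two `ℚ`-algebra structures on `CyclotomicField m ℚ`, `DivisionRing.toRatAlgebra`
versus the structural `CyclotomicField.instAlgebra`, as in Mathlib's
`NumberTheory/Cyclotomic/Basic.lean`.) [folklore] -/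
def cyclotomicCharacterOf (χ : DirichletCharacter ℂ m) :
    (CyclotomicField m ℚ ≃ₐ[ℚ] CyclotomicField m ℚ) →* ℂˣ :=
  χ.toUnitHom.comp
    (IsCyclotomicExtension.autEquivPow (CyclotomicField m ℚ)
      (cyclotomic.irreducible_rat (NeZero.pos m))).toMonoidHom

set_option backward.isDefEq.respectTransparency false in
/-- `cyclotomicCharacterOf χ σ = χ(a)` where `σ(ζ) = ζ^a`, i.e. `a = autEquivPow σ`. [folklore] -/
theorem coe_cyclotomicCharacterOf_apply (χ : DirichletCharacter ℂ m)
    (σ : CyclotomicField m ℚ ≃ₐ[ℚ] CyclotomicField m ℚ) :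
    (cyclotomicCharacterOf χ σ : ℂ) =
      χ ((IsCyclotomicExtension.autEquivPow (CyclotomicField m ℚ)
        (cyclotomic.irreducible_rat (NeZero.pos m)) σ : (ZMod m)ˣ) : ZMod m) := by
  simp [cyclotomicCharacterOf]

end Cyclotomic

/-! ### Kato, Cor. 14.3 (2), for elliptic curves over `ℚ` and `K = ℚ(ζ_m)` -/

section Kato

open ModularForms

open scoped Classical in
/-- **Kato's theorem: a non-vanishing central twisted `L`-value kills the `χ`-part of the
Mordell–Weil group over `ℚ(ζ_m)`** (K. Kato, Astérisque 295 (2004), Cor. 14.3 (2), p. 235, of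
Thm. 14.2 (2)). Let `E/ℚ` be an elliptic curve (Weierstrass model `W`) with newform
`f ∈ S₂(Γ₀(N))` (`IsNewformOf W f`: `aₙ(f) = aₙ(E)` for all `n`; in particular `E` is a quotient
of `J₀(N)`, hence of `J₁(N)`, as Cor. 14.3 requires, and `L(E, χ, s) = L(f, χ, s)`), let `m ≥ 1`
with `m ≢ 2 (mod 4)`, `K = ℚ(ζ_m)` (so `m` is the least modulus with `K ⊂ ℚ(ζ_m)` and the primes
ramified in `K` are those dividing `m`), and let `χ` be a Dirichlet character mod `m`, viewed as the
character `cyclotomicCharacterOf χ` of `G = Gal(K/ℚ) ≅ (ℤ/m)ˣ`. If `L(f, χ, 1) ≠ 0` — i.e. some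
(equivalently, the) entire continuation `L` of `L_{prime(m)}(f, χ, s) = ∑_{n} χ(n) aₙ(f) n⁻ˢ`
(`twistedLSeries f χ`, `re s > 2`) has `L(1) ≠ 0` — then the `χ`-part
`E(K)^(χ) = {x ∈ E(K) ; I_χ · x = 0}` of the Mordell–Weil group `E(K)`, for the Galois action
`σ ↦ Point.map σ` of `G` on `E(K) = (W.baseChange K)(K)`, is finite.
As printed (Cor. 14.3): "Let `A` be an abelian variety over `ℚ` such that there is a surjective
homomorphism `J₁(N) → A` for some `N ≥ 1` […]. Let `K` be a finite abelian extension of `ℚ`, let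
`χ : Gal(K/ℚ) → ℂˣ` be a character, and assume `L(A, χ, 1) ≠ 0`. Then: (1) The `χ`-part
`Sel(K, A ⊗_ℚ K)^(χ)` of `Sel(K, A ⊗_ℚ K)` is finite. (2) The `χ`-part `A(K)^(χ)` is finite."
Here `A = E`, `K = ℚ(ζ_m)`; part (1) and general abelian `K` are not vendored (module docstring).
[cite: Kato2004Asterisque, Cor. 14.3 (2) (p. 235)] -/
def kato_finite_chiPart_of_twistedLValue_ne_zero : Prop :=
  ∀ (W : WeierstrassCurve ℚ) [W.IsElliptic] {N : ℕ} [NeZero N] {f : CuspForm (Gamma0 N) 2}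
    (_hf : IsNewformOf W f) {m : ℕ} [NeZero m] (_hm : m % 4 ≠ 2) (χ : DirichletCharacter ℂ m)
    (_hL : ∃ L : ℂ → ℂ, Differentiable ℂ L ∧
      (∀ s : ℂ, 2 < s.re → L s = twistedLSeries f χ s) ∧ L 1 ≠ 0),
    Finite (chiPart
      (fun σ : CyclotomicField m ℚ ≃ₐ[ℚ] CyclotomicField m ℚ =>
        Point.map (W' := W.toAffine) (σ : CyclotomicField m ℚ →ₐ[ℚ] CyclotomicField m ℚ))
      (fun σ => (cyclotomicCharacterOf χ σ : ℂ)))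

end Kato

end Literature.NumberTheory.EllipticCurves

end

/-! ## Relocated from `Summits/BirchSwinnertonDyer/BirchSwinnertonDyer/Theorems/PlecticLegsKatoDescentOfFact.lean` (gate, accept-time relocation of cited facts) — Kato2004Asterisque -/

namespace Literature.NumberTheory.EllipticCurves

/-- **Kato's theorem: a non-vanishing central twisted `L`-value kills the `χ`-part of the
Mordell–Weil group over `ℚ(ζ_m)`, every `m ≥ 1`** (K. Kato, *`p`-adic Hodge theory and values of
zeta functions of modular forms*, Astérisque 295 (2004), Cor. 14.3 (2), p. 235, of Thm. 14.2 (2)).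
As printed: "Let `A` be an abelian variety over `ℚ` such that there is a surjective homomorphism
`J₁(N) → A` for some `N ≥ 1` […]. Let `K` be a finite abelian extension of `ℚ`, let
`χ : Gal(K/ℚ) → ℂˣ` be a character, and assume `L(A, χ, 1) ≠ 0`. Then: (1) The `χ`-part
`Sel(K, A ⊗_ℚ K)^(χ)` of `Sel(K, A ⊗_ℚ K)` is finite. (2) The `χ`-part `A(K)^(χ)` is finite." Here
(p. 235) `M^(χ) = {x ∈ M ; I_χ · x = 0}` with `I_χ = ker(ℤ[Gal(K/ℚ)] → ℂ)`
(`Literature.NumberTheory.EllipticCurves.chiPart`), and `L(·, χ, s)` means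
`L_S(·, χ, s) = ∑_{(n,S)=1} aₙ χ(n) n⁻ˢ`, `S = prime(m₀)` for the least `m₀` with `K ⊂ ℚ(ζ_{m₀})`.
This statement is part (2) for `A = E` an elliptic curve over `ℚ` with newform
`f ∈ S₂(Γ₀(N))` (`IsNewformOf W f`, so `E` is a quotient of `J₀(N)`, hence of `J₁(N)`, and
`L(E, χ, s) = L(f, χ, s)`), `K = ℚ(ζ_m)` (`CyclotomicField m ℚ`, ANY `m ≥ 1`), `χ` a Dirichlet
character mod `m` viewed as the character `cyclotomicCharacterOf χ` of `Gal(K/ℚ) ≅ (ℤ/m)ˣ`, the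
Galois action on `E(K)` being `σ ↦ Point.map σ`, and the hypothesis spelled, as in the tree's
`kato_finite_chiPart_of_twistedLValue_ne_zero`, through an entire continuation `L` of the mod-`m`
series `twistedLSeries f χ s = ∑ χ(n) aₙ(f) n⁻ˢ = L_{prime(m)}(f, χ, s)` (`re s > 2`) with
`L(1) ≠ 0`; the decidability instance on `K` used by Mathlib's group law on `E(K)` is quantified
(all such instances are equal; the tree's files use the classical one). For `m ≢ 2 (mod 4)`
(`m₀ = m`) this is verbatim the vendored statement; for
`m ≡ 2 (mod 4)` one has `m₀ = m/2`, `ℚ(ζ_m) = ℚ(ζ_{m/2})`, `2 ∉ S`, and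
`L_{prime(m)}(f, χ, s) = (1 - χ₀(2) a₂ 2⁻ˢ + χ₀(2)² 𝟙_N(2) 2^{1-2s}) · L_S(f, χ₀, s)` with `χ₀` the
character mod `m/2` inducing `χ` (Euler product of `f ⊗ χ₀`, Shimura 1971 Thm. 3.66), the first
factor being an entire polynomial in `2⁻ˢ`; hence `L_{prime(m)}(f, χ, 1) ≠ 0` forces Kato's
hypothesis `L_S(f, χ₀, 1) ≠ 0`, and `I_χ = I_{χ₀}` in `ℤ[Gal(K/ℚ)]`, so the printed corollary gives
exactly this conclusion. Part (1) and general abelian `K` are not vendored.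
-- TODO(general form): `K` an arbitrary finite abelian extension of `ℚ` and part (1) (Selmer).
[cite: Kato2004Asterisque, Cor. 14.3 (2) (p. 235)]
[file NumberTheory/EllipticCurves/KatoTwistedFiniteness] -/
def kato_finite_chiPart_cyclotomic_of_twistedLValue_ne_zero : Prop :=
  ∀ (W : WeierstrassCurve ℚ) [W.IsElliptic] {N : ℕ} [NeZero N]
    {f : CuspForm (CongruenceSubgroup.Gamma0 N) 2}
    (_hf : Literature.NumberTheory.EllipticCurves.ModularForms.IsNewformOf W f) {m : ℕ} [NeZero m]
    [DecidableEq (CyclotomicField m ℚ)] (χ : DirichletCharacter ℂ m)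
    (_hL : ∃ L : ℂ → ℂ, Differentiable ℂ L ∧
      (∀ s : ℂ, 2 < s.re →
        L s = Literature.NumberTheory.EllipticCurves.ModularForms.twistedLSeries f χ s) ∧ L 1 ≠ 0),
    Finite (Literature.NumberTheory.EllipticCurves.chiPart
      (fun σ : CyclotomicField m ℚ ≃ₐ[ℚ] CyclotomicField m ℚ =>
        WeierstrassCurve.Affine.Point.map (W' := W.toAffine)
          (σ : CyclotomicField m ℚ →ₐ[ℚ] CyclotomicField m ℚ))
      (fun σ => (Literature.NumberTheory.EllipticCurves.cyclotomicCharacterOf χ σ : ℂ)))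

end Literature.NumberTheory.EllipticCurves
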